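/-
Copyright: statement-level skeleton of a published paper (lit-balaban cell, Phase-2 proof seat p13, gen 11). No proof
claims beyond what the kernel checks below.
-/
import Literature.MathematicalPhysics.QuantumFieldTheory.BalabanImbrieJaffe1984to88.BIJ88Ineq5714Bridge
import Literature.MathematicalPhysics.QuantumFieldTheory.BalabanImbrieJaffe1984to88.BIJ88SmallChargeRegime

/-!
# `BalabanImbrieJaffe1984to88.BIJ88Ineq5714BridgeSmall` — T. Bałaban, J. Imbrie, A. Jaffe, *Effective action and cluster properties
of the abelian Higgs model*, Commun. Math. Phys. **114** (1988) 257–315 [BalabanImbrieJaffe1988]: Sect. 5.7, p. 295 — **(5.7.14)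
FROM THE WORD MODELS OF RECORD FOR `e_k ≪ 1`**: the bridge `BIJ88Ineq5714Bridge.ineq5714_wordModel_closed` with every regime
hypothesis discharged by `e_k < δ` (p36's `BIJ88SmallChargeRegime`)

statement-level skeleton of published theorems with citation tags; proofs where landed; nothing here is a claim about the Yang–Mills mass gap

PDF held: `paper:balaban1988-cmp114-bij-abelian-higgs-effective-action` (journal page = PDF page + 256); p. 295 [PDF 39] and p. 291
[PDF 35] read as IMAGES (CCITT renders `HOME/lit-balaban-p13/pages/original-p039-x2.png`, `-p035-x2.png`).

CITATION HEADER (lean-in-tree rule).  Part of the lit-balaban TYPED SKELETON (HOME `run/shared/lean/pub/lit-balaban/`): row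
**C2.Eq5.7.13-5.7.15** of `HOME/lit-balaban-r16/ROWS-C2-part2.md` (claim; owner's refined flip condition (i)); unit `lit-balaban-p13`
(gen 11), owner r16, referee ref-5.  Built BY NAME on `BIJ88Ineq5714Bridge` (v1.1: `ineq5714_wordModel_closed`, `s1_regime`) and p36's
`BIJ88SmallChargeRegime.regime5714`/`regime579`/`eventually_const_le_mul_log_rpow`/`exists_threshold`; nothing restated.

**The print.** (5.7.14) p. 295: *"|W₂^{(k)}(X)| ≤ e_k^κ e^{−cr(e_k)|X|^−} + Σ_{j<k} e_j^{1−α} e^{−cr(e_k)|X|} |B_{k−j−1}(X) ∩ Λ₅^{(j)′} ∩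
Λ₆^{(j+1)c}|"*; p. 291: *"We can take κ arbitrarily large by increasing n̄."*

**What is kernel-checked (one theorem, zero `sorry`, no definitions, no `Prop` facts).**  `ineq5714_wordModel_small`: there is
`δ = δ(L, d, r, c, κ, τ, α, θ) > 0` such that for every scale `k` with `e_k < δ` the six scale-indexed families of word models of
`BIJ88Ineq5714Bridge` (W′ `HighOrderModel`s, W″/W⁽ᵛⁱ⁾ `LocalizedModel`s — the `j = k` member of the ″-family at the rate `c` with cube
size `s ≤ r(e_k)^d` — and W‴/W⁽ⁱᵛ⁾/W⁽ᵛ⁾/W⁽ᵛⁱ⁾_k `RemainderModel`s) give the leaf `Ineq5714 (cubePolymers ι₀) W₂ k e lfVol (κ−τ) (α+τ)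
(c/2) r(e_k)` OUTRIGHT — the hypotheses `e_k ≤ 1`, per-scale gain `≥ log 2`, `κ ≤ (c/2)(log e_k⁻¹)^{r−1}`, `(2/(1−q^κ)+8)e_k^τ ≤ 1`,
`(c/2)r(e_k) ≥ 1`, `r(e_k)^d ≤ e_k^{−θ}` and `κ − 1 + α + θ ≤ (c/2)(log e_k⁻¹)^{r−1}` all holding for small `e_k`.  HONEST SCOPE: as in
`BIJ88Ineq5714Bridge` (pure composition; region geometry and the identification of the families with the print's expansions are
hypotheses).  NOT summit progress; NOT continuum; NOT Clay.  Imports Literature only; modifies nothing.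
-/

namespace Literature.MathematicalPhysics.QuantumFieldTheory.BalabanImbrieJaffe1984to88.BIJ88Ineq5714BridgeSmall

open Finset
open BIJ88TraceTerms579 (cubePolymers)
open BIJ88Sect2Statements (rLen eK)
open BIJ88Sect5StatementsPart2 (Ineq5714)
open BIJ88W2Localized292 (vol)
open BIJ88Ineq5714Bridge
open scoped Matrix Matrix.Norms.Operator

variable {T A B : Type*} [Fintype T] [DecidableEq T] [Fintype A] [DecidableEq A] [Fintype B] [DecidableEq B]
variable {ι₀ : Type} [DecidableEq ι₀]

section Small

open Filter Set
open scoped Topology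

omit [DecidableEq A] [DecidableEq B] in
/-- **(5.7.14) FROM THE WORD MODELS OF RECORD, FOR `e_k ≪ 1`** — `ineq5714_wordModel_closed` with every regime hypothesis (`e_k ≤ 1`,
the per-scale gain `≥ log 2`, `κ ≤ (c/2)(log e_k⁻¹)^{r−1}`, `(2/(1−q^κ)+8)e_k^τ ≤ 1`, `(c/2)r(e_k) ≥ 1`, `r(e_k)^d ≤ e_k^{−θ}`,
`κ − 1 + α + θ ≤ (c/2)(log e_k⁻¹)^{r−1}`) DISCHARGED by `e_k < δ`, `δ = δ(L, d, r, c, κ, τ, α, θ) > 0` (p36's `regime5714`/`regime579`,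
`BIJ88SmallChargeRegime`), the cube size at scale `k` entering as `s ≤ r(e_k)^d`: *"We can take κ arbitrarily large by increasing n̄"*
(p. 291) — for the running charge small enough, the six families of word models give the leaf (5.7.14) outright.
[cite: BalabanImbrieJaffe1988, (5.7.14) p.295, (5.7.9) p.291] -/
theorem ineq5714_wordModel_small {L e ε₀ : ℝ} {d : ℕ} (hL : 1 < L) (he : 0 < e) (hε₀ : 0 < ε₀) (hd : d < 4)
    {r c θ α₁ α τ : ℝ} {nbar : ℕ} (hr : 1 < r) (hc : 0 < c) (hτ : 0 < τ) (hθ : 0 < θ)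
    (hκ : 0 < (nbar : ℝ) + 1 - α₁ - 2 * (d : ℝ) / (4 - (d : ℝ)) - θ) :
    ∃ δ > 0, ∀ (k : ℕ), eK L e ε₀ d k < δ →
      ∀ (F₁ F₂ F₃ F₄ F₅ F₆ : Family T A B ι₀) [∀ j l, DecidablePred (F₁.S j l)] [∀ j l, DecidablePred (F₂.S j l)]
        [∀ j l, DecidablePred (F₃.S j l)] [∀ j l, DecidablePred (F₄.S j l)] [∀ j l, DecidablePred (F₅.S j l)]
        [∀ j l, DecidablePred (F₆.S j l)] (R₂ R₆ : ℕ → Finset T) (lfVol : ℕ → Finset ι₀ → ℕ),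
      (∀ j X, vol (F₂.cube j) (R₂ j) X ≤ lfVol j X) → (∀ j X, vol (F₆.cube j) (R₆ j) X ≤ lfVol j X) →
      (∀ j, j ≤ k → HighOrderModel (F₁.cube j) (F₁.Cl j) (F₁.sC j) (F₁.Wl j) (F₁.sW j) (F₁.S j) L e ε₀ r c θ α₁ d j k nbar) →
      (∀ j, j < k → LocalizedModel (F₂.cube j) (F₂.Cl j) (F₂.sC j) (F₂.Wl j) (F₂.sW j) (F₂.S j) (R₂ j)
        (eK L e ε₀ d j) α (c / 2) (rLen r (eK L e ε₀ d k))) →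
      LocalizedModel (F₂.cube k) (F₂.Cl k) (F₂.sC k) (F₂.Wl k) (F₂.sW k) (F₂.S k) (R₂ k)
        (eK L e ε₀ d k) α c (rLen r (eK L e ε₀ d k)) →
      ∀ {s : ℕ}, (∀ cb : ι₀, (Finset.univ.filter fun x => F₂.cube k x = cb).card ≤ s) →
      ((s : ℝ) ≤ rLen r (eK L e ε₀ d k) ^ d) →
      (∀ j, j ≤ k → RemainderModel (F₃.cube j) (F₃.Cl j) (F₃.sC j) (F₃.Wl j) (F₃.sW j) (F₃.S j) (c / 2)
        (rLen r (eK L e ε₀ d j))) →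
      (∀ j, j ≤ k → RemainderModel (F₄.cube j) (F₄.Cl j) (F₄.sC j) (F₄.Wl j) (F₄.sW j) (F₄.S j) (c / 2)
        (rLen r (eK L e ε₀ d j))) →
      (∀ j, j ≤ k → RemainderModel (F₅.cube j) (F₅.Cl j) (F₅.sC j) (F₅.Wl j) (F₅.sW j) (F₅.S j) (c / 2)
        (rLen r (eK L e ε₀ d j))) →
      (∀ j, j < k → LocalizedModel (F₆.cube j) (F₆.Cl j) (F₆.sC j) (F₆.Wl j) (F₆.sW j) (F₆.S j) (R₆ j)
        (eK L e ε₀ d j) α (c / 2) (rLen r (eK L e ε₀ d k))) →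
      RemainderModel (F₆.cube k) (F₆.Cl k) (F₆.sC k) (F₆.Wl k) (F₆.sW k) (F₆.S k) (c / 2) (rLen r (eK L e ε₀ d k)) →
      Ineq5714 (cubePolymers ι₀)
        (fun X => ∑ j ∈ Finset.range (k + 1), (F₁.W j X + F₂.W j X + F₃.W j X + F₄.W j X + F₅.W j X + F₆.W j X))
        k (fun j => eK L e ε₀ d j) lfVol
        (((nbar : ℝ) + 1 - α₁ - 2 * (d : ℝ) / (4 - (d : ℝ)) - θ) - τ) (α + τ) (c / 2) (rLen r (eK L e ε₀ d k)) := by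
  have hL0 : 0 < L := by linarith
  set κ : ℝ := (nbar : ℝ) + 1 - α₁ - 2 * (d : ℝ) / (4 - (d : ℝ)) - θ with hκdef
  -- p36's regimes at the rate c/2, the (5.7.9) regime, and the exponent of `s1_regime`
  obtain ⟨δ₁, hδ₁, hreg₁⟩ := BIJ88SmallChargeRegime.regime5714 hL hd κ τ hr (half_pos hc) hτ
  obtain ⟨δ₂, hδ₂, hreg₂⟩ := BIJ88SmallChargeRegime.regime579 θ d (by linarith : (0 : ℝ) < r) hc hθ
  obtain ⟨δ₃, hδ₃, hreg₃⟩ := BIJ88SmallChargeRegime.exists_threshold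
    (BIJ88SmallChargeRegime.eventually_const_le_mul_log_rpow (κ - 1 + α + θ) (c / 2) (r - 1) (half_pos hc) (by linarith))
  refine ⟨min δ₁ (min δ₂ δ₃), lt_min hδ₁ (lt_min hδ₂ hδ₃), ?_⟩
  intro k hk F₁ F₂ F₃ F₄ F₅ F₆ _ _ _ _ _ _ R₂ R₆ lfVol hvol₂ hvol₆ h1 h2 h2k s hs hsd h3 h4 h5 h6 h6k
  have hek : 0 < eK L e ε₀ d k := BIJ88ScaleSums.eK_pos hL0 he hε₀ k
  obtain ⟨hek1, hg, hκR, hAτ⟩ := hreg₁ _ hek (lt_of_lt_of_le hk (min_le_left _ _))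
  obtain ⟨-, hcr, hpoly⟩ := hreg₂ _ hek (lt_of_lt_of_le hk ((min_le_right _ _).trans (min_le_left _ _)))
  have hκR' := hreg₃ _ hek (lt_of_lt_of_le hk ((min_le_right _ _).trans (min_le_right _ _)))
  have hg' : Real.log 2 ≤ c / 2 * r * Real.log (eK L e ε₀ d k)⁻¹ ^ (r - 1) * ((4 - (d : ℝ)) / 2 * Real.log L) := hg
  exact ineq5714_wordModel_closed hL he hε₀ hd k hek1 hr hc hτ hκ F₁ F₂ F₃ F₄ F₅ F₆ R₂ R₆ lfVol hvol₂ hvol₆ h1 h2 h2k hs hcr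
    (s1_regime hek hek1 hr hsd hpoly hκR') h3 h4 h5 h6 h6k hg' hκR hAτ

end Small

end Literature.MathematicalPhysics.QuantumFieldTheory.BalabanImbrieJaffe1984to88.BIJ88Ineq5714BridgeSmall
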